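import Summits.QuantumFields.BalabanUV.T4Continuum.Support.T4TrajectoryDensityDressed

/-!
# `T4Continuum.T4TrajectoryDensityDressedLoop` (part 2 of 2 of the (w2)-SPLIT; part 1 = `T4TrajectoryDensityDressed`) — the
# CARRIED observable-attached terms: manufactured as perturbation slices from their birth slices on the coarser window, transported
# through one normalised complex-weight step by the printed small-field bound (1.75), the consistency of the dressed capstone with
# v1.2.1, and the SCALAR SIZE BOOKKEEPING along the trajectory with the exact missing inequality typed (cell `pub-balaban`, sub-cell
# `t4`, spine estimate NE1′ (node O3b/H2), lineage t4-ne1p-p1 = PROVER seat P1, technique «RG-trajectory comparison: extend B12's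
# (2.18) inductive representation term by term with the observable insertion, tracking μ-uniformity through the printed small-field
# bounds», generation 21; tree target `Summits/QuantumFields/BalabanUV/T4Continuum/Support/`; ADDITIVE — imports part 1 ONLY)

HONEST FRAMING.  Finite four-torus, rung (B)+1 only — NOT infinite volume, NOT a mass gap, NOT the Clay problem, NOT summit
progress.  «continuum YM on T⁴ ⇐ BetaPertH ∧ nine spine estimates (0/9 proved); BetaPertH ⇐ (D1) ∧ (D4) ∧ CAP+tail; G-an2-4 gates
asym, D1 and NE2/3/4».  ABSOLUTE RULE honoured: every declaration is [folklore] kernel mathematics, 0 sorry, 0 citations; the printed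
kernels (1.73)–(1.75) of [Balaban1989LargeFieldII] p. 380 enter BY NAME through the Literature leaf `T4TrajectoryDensity`
(`norm_ratio_le`, `integral_weight_ne_zero`); NOTHING is said about Bałaban's densities (cell wall (w1)–(w7) of record
`t4/T4-EST-NE1p-P1.md`, unchanged except that (w2) is now split as part 1's header says).

CONTENTS.  §5 `pertSlice_of_birthSlice_shift`: a carried term `(U, z) ↦ G (U + z)` whose `G` has a birth slice of radius `r` and
size `A` on the COARSE window is a perturbation slice of size `A` and ANY radius `ϱ < r` on the FINE window (common holomorphy domain
= the open tube of radius `r / N d` about `[0,1]`; inputs = the pipeline's own nesting (N1) a.e. and the measurability of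
`z ↦ G (U + z)`; the chart need only commute with translation by the fluctuation variable, `latMove_add_right`).  §6
`birthSlice_wOp_shift`: the SAME carried term integrated against one projective weight slice with oscillation `s ≤ 1` has a birth
slice of radius `ϱ` and size `e^{3s}·A` on the fine window — the moving-integrand form of the leaf's `opSliceOn_wOp` (dominated
holomorphic differentiation of numerator and denominator on `Ω ∩ tube`, (1.74) for the denominator, (1.75) for the bound); dressed
corollary `birthSlice_wOp_shift_dressed`.  §7 CONSISTENCY: the v1.2.1 capstone's statement re-derived from part 1's dressed capstone
at `𝒬 = 0` (an `example`: its type IS the landed v1.2.1 theorem's, which stays the citable one).  §8 THE SCALAR BOOKKEEPING (μ-UNIFORMITY, TYPED): along a trajectory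
the size of a carried observable-attached term obeys `A_{k+1} ≤ e^{3(s⁰_k + s₁_k)}·A_k` (§6), so `A_k ≤ A_0·e^{3Σ_{i<k}(s⁰_i+s₁_i)}`
(`size_le_of_rec`) — K-UNIFORM iff the oscillation budgets are SUMMABLE along the trajectory (`size_uniform_of_summable`: the typed
input OBS-SUM `Σ_{k<K} s₁_k ≤ S₁`, `S₁` independent of `K`); and WITHOUT an oscillation-decay input, feeding the sup form `s₁_k = m·A_k`
(§5, `m` ∝ the source strength `|μ|`) back into the recursion gives `A_k ≥ A_0·(1 + 3mA_0)^k` (`size_lb_noContraction`), whence a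
per-step budget at the last met step forces `m·A_0·(1 + 3mA_0)^K ≤ 1/2` (`source_bound_noContraction`): the admissible source
strength SHRINKS with the number `K` of met steps.  THE EXACT MISSING INEQUALITY of wall clause (w2-obs) is therefore OBS-SUM — a
K-uniform bound on the summed OSCILLATIONS (not sizes) of the observable-attached exponent in the fluctuation variables along the
trajectory — which print does not supply ([Balaban1987RGI]–[Balaban1989LargeFieldII] carry no observable; print gives only a
PER-STEP bound on the ACTION's `σ`: p. 379 «this bound is small», p. 388 «we have estimated the expression |σ| in (1.73) by 1» —
v1.0.2 locator fix of v1.0.1's «(1.72)», which is the 𝐑-operation formula) and which this leaf does NOT assert.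
-/

namespace Summit.QuantumFields.BalabanUV.T4Continuum.T4TrajectoryDensityDressed

open MeasureTheory Set Metric Filter
open Literature.MathematicalPhysics.QuantumFieldTheory.Balaban1983to89
open T4TermFormat T4TermFormat.Booking T4GatedBooking T4TrajectoryComparison T4TrajectoryModulus
open T4BirthChartTransport (GaugeInvariant BirthSlice RelGauge)
open T4BlockTransport (Fld NDir latMove latN)
open T4TrajectoryDensity

noncomputable section

/-! ## §5 Manufacturing the perturbation slice from a CARRIED term's birth slice on the coarser window [folklore] -/

section Carried

/-- Disc-in-tube: for `ϱ < r` and `0 < n`, the closed disc of radius `ϱ / n` about a point of `[0,1]` lies in the open tube of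
radius `r / n` about `[0,1]`. [folklore] -/
theorem closedBall_subset_tube {ϱ r n : ℝ} (hn : 0 < n) (hϱr : ϱ < r) {x : ℝ} (hx : x ∈ Icc (0 : ℝ) 1) :
    closedBall (x : ℂ) (ϱ / n) ⊆ tube (r / n) := by
  intro y hy
  refine mem_thickening_iff.mpr ⟨(x : ℂ), ?_, lt_of_le_of_lt (mem_closedBall.mp hy) (div_lt_div_of_pos_right hϱr hn)⟩
  rw [segment_eq_image]
  exact ⟨x, hx, by simp⟩

variable {V : Type*} [AddCommGroup V] [MeasurableSpace V] {Dir : Type*} {move : V → Dir → ℂ → V} {N : Dir → ℝ}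

/-- **A CARRIED TERM IS A PERTURBATION SLICE ON THE FINER WINDOW.**  If `G` has a birth slice of radius `r` and size `A` on the
coarse window `𝒦big` along a chart `move` commuting with translation by the fluctuation variable, the fluctuation variable a.e.
keeps `U₀ + z` in `𝒦big` for `U₀` in the fine window `𝒦` (nesting (N1) + a.e. membership), and `z ↦ G (U + z)` is a.e.-strongly
measurable for every `U`, then `(U, z) ↦ G (U + z)` is a perturbation slice on `𝒦` of size `A` (about the constant `0`) and ANY
radius `ϱ < r`: the common holomorphy domain is the open tube of radius `r / N d` about `[0,1]`. [folklore] -/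
theorem pertSlice_of_birthSlice_shift {G : V → ℂ} {μ : Measure V} {𝒦 𝒦big : Set V} {w ϱ r A : ℝ}
    (hmove : ∀ (U z : V) (d : Dir) (t : ℂ), move (U + z) d t = move U d t + z)
    (hsl : BirthSlice G move N 𝒦big w r A) (hnest : ∀ᵐ z ∂μ, ∀ U₀ ∈ 𝒦, U₀ + z ∈ 𝒦big)
    (hmeas : ∀ U, AEStronglyMeasurable (fun z => G (U + z)) μ) (hϱr : ϱ < r) :
    PertSlice (fun U z => G (U + z)) μ move N 𝒦 w ϱ A := by
  refine pertSlice_of_sup fun U₀ hU₀ d hd hdw => ?_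
  refine ⟨tube (r / N d), isOpen_tube _, fun x hx => closedBall_subset_tube hd hϱr hx, fun t _ => hmeas (move U₀ d t), ?_, ?_⟩
  · filter_upwards [hnest] with z hz
    obtain ⟨Dm, hdiff, -, hDm⟩ := hsl (U₀ + z) (hz U₀ hU₀) d hd hdw
    have e : (fun t => G (move U₀ d t + z)) = fun t => G (move (U₀ + z) d t) := by
      funext t
      rw [hmove]
    rw [e]
    exact hdiff.mono (tube_subset hDm)
  · filter_upwards [hnest] with z hz t ht
    obtain ⟨Dm, -, hbd, hDm⟩ := hsl (U₀ + z) (hz U₀ hU₀) d hd hdw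
    rw [← hmove]
    exact hbd t (tube_subset hDm ht)

/-! ## §6 Transporting a carried term's birth slice through one normalised complex-weight step (moving integrand) [folklore] -/

variable {F : Type*} [NormedAddCommGroup F] [NormedSpace ℂ F]

/-- **ONE DRESSED STEP OF A CARRIED TERM.**  One PROJECTIVE weight slice for `ω` on the fine window `𝒦` (radius `ϱ`, oscillation
`s ≤ 1`), a carried term `G` with a birth slice of radius `r > ϱ` and size `A ≥ 0` on the coarse window along a translation-commuting
chart, the a.e. nesting and the measurability of `z ↦ G (U + z)`: then the transformed term `U ↦ wOp ω μ z₀ U (z ↦ G (U + z))` has a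
birth slice on `𝒦` of radius `ϱ` and size `e^{3s}·A` — holomorphy of numerator and denominator on `Ω ∩ tube (r / N d)` by dominated
holomorphic differentiation (majorants `|ρ₀|e^{s}·A`, `|ρ₀|e^{s}`), non-vanishing of the denominator by (1.74)
(`integral_weight_ne_zero`), the bound by (1.75) (`norm_ratio_le`), the projective constant cancelling. [folklore] -/
theorem birthSlice_wOp_shift {ω : V → V → ℂ} {μ : Measure V} {z₀ : V} {𝒦 𝒦big : Set V} {w ϱ s r A : ℝ} {G : V → F}
    (hmove : ∀ (U z : V) (d : Dir) (t : ℂ), move (U + z) d t = move U d t + z)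
    (hws : WeightSliceProj ω μ move N 𝒦 w ϱ s) (hs : s ≤ 1) (hsl : BirthSlice G move N 𝒦big w r A)
    (hnest : ∀ᵐ z ∂μ, ∀ U₀ ∈ 𝒦, U₀ + z ∈ 𝒦big) (hmeas : ∀ U, AEStronglyMeasurable (fun z => G (U + z)) μ)
    (hϱr : ϱ < r) (hA : 0 ≤ A) :
    BirthSlice (fun U => wOp ω μ z₀ U (fun z => G (U + z))) move N 𝒦 w ϱ (Real.exp (3 * s) * A) := by
  intro U₀ hU₀ p hp hpw
  obtain ⟨Ω, hΩ, hballs, ρ₀, hρ0, hρ, hP, σ, hσm, hσd, hσb, c, hc, hfac⟩ := hws U₀ hU₀ p hp hpw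
  -- the carried integrand along the slice: `H t z = G (move U₀ p t + z)`, holomorphic and bounded on the tube for a.e. `z`
  have hHd : ∀ᵐ z ∂μ, DifferentiableOn ℂ (fun t => G (move U₀ p t + z)) (tube (r / N p)) := by
    filter_upwards [hnest] with z hz
    obtain ⟨Dm, hdiff, -, hDm⟩ := hsl (U₀ + z) (hz U₀ hU₀) p hp hpw
    have e : (fun t => G (move U₀ p t + z)) = fun t => G (move (U₀ + z) p t) := by
      funext t
      rw [hmove]
    rw [e]
    exact hdiff.mono (tube_subset hDm)
  have hHb : ∀ᵐ z ∂μ, ∀ t ∈ tube (r / N p), ‖G (move U₀ p t + z)‖ ≤ A := by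
    filter_upwards [hnest] with z hz t ht
    obtain ⟨Dm, -, hbd, hDm⟩ := hsl (U₀ + z) (hz U₀ hU₀) p hp hpw
    rw [← hmove]
    exact hbd t (tube_subset hDm ht)
  have hHb' : ∀ t ∈ tube (r / N p), ∀ᵐ z ∂μ, ‖G (move U₀ p t + z)‖ ≤ A := fun t ht => hHb.mono fun z hz => hz t ht
  have hσb' : ∀ t ∈ Ω, ∀ᵐ z ∂μ, ‖σ t z‖ ≤ s := fun t ht => hσb.mono fun z hz => hz t ht
  -- the weight at the moved configuration: integrable, a.e. equal to `c · ρ₀ e^{σ_t}`, of nonzero mass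
  have hWint : ∀ t ∈ Ω, Integrable (weight ρ₀ (σ t)) μ := fun t ht => integrable_weight hρ (hσm t ht) (hσb' t ht)
  have hωint : ∀ t ∈ Ω, Integrable (ω (move U₀ p t)) μ :=
    fun t ht => ((hWint t ht).const_mul c).congr (hfac t ht).symm
  have hωW : ∀ t ∈ Ω, ∫ z, ω (move U₀ p t) z ∂μ = c * ∫ z, weight ρ₀ (σ t) z ∂μ := by
    intro t ht
    rw [integral_congr_ae (hfac t ht)]
    simpa only [smul_eq_mul] using integral_smul c (weight ρ₀ (σ t))
  have hωWh : ∀ t ∈ Ω, ∫ z, ω (move U₀ p t) z • G (move U₀ p t + z) ∂μ =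
      c • ∫ z, weight ρ₀ (σ t) z • G (move U₀ p t + z) ∂μ := by
    intro t ht
    rw [← integral_smul]
    exact integral_congr_ae ((hfac t ht).mono fun z hz => by simp only [hz, mul_smul])
  have hne : ∀ t ∈ Ω, (∫ z, weight ρ₀ (σ t) z ∂μ) ≠ 0 :=
    fun t ht => integral_weight_ne_zero hρ hρ0 (hσm t ht) (hσb' t ht) hs hP
  have hEq : ∀ t ∈ Ω, wOp ω μ z₀ (move U₀ p t) (fun z => G (move U₀ p t + z)) =
      (∫ z, weight ρ₀ (σ t) z ∂μ)⁻¹ • ∫ z, weight ρ₀ (σ t) z • G (move U₀ p t + z) ∂μ := by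
    intro t ht
    rw [wOp_of_pos (hωint t ht) (by rw [hωW t ht]; exact mul_ne_zero hc (hne t ht)), hωW t ht, hωWh t ht, smul_smul]
    congr 1
    field_simp
  refine ⟨Ω ∩ tube (r / N p), ?_, ?_, fun x hx => subset_inter (hballs x hx) (closedBall_subset_tube hp hϱr hx)⟩
  · -- holomorphy of denominator and numerator by dominated differentiation, then of the ratio
    beta_reduce
    have hG : DifferentiableOn ℂ (fun t => ∫ z, weight ρ₀ (σ t) z ∂μ) Ω := by
      refine Literature.Analysis.Complex.differentiableOn_integral_of_dominated
        (fun t ht => aestronglyMeasurable_weight hρ.1 (hσm t ht)) ?_ ?_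
      · filter_upwards [hσd] with z hz
        exact hz.cexp.const_mul (ρ₀ z : ℂ)
      · intro t₀ ht₀
        obtain ⟨R', hR', hRΩ⟩ := Metric.isOpen_iff.mp hΩ t₀ ht₀
        refine ⟨R', hR', hRΩ, fun z => ‖ρ₀ z‖ * Real.exp s, hρ.norm.mul_const _, ?_⟩
        filter_upwards [hσb] with z hz t ht
        rw [Real.norm_eq_abs]
        exact norm_weight_le (hz t (hRΩ ht))
    have hH : DifferentiableOn ℂ (fun t => ∫ z, weight ρ₀ (σ t) z • G (move U₀ p t + z) ∂μ) (Ω ∩ tube (r / N p)) := by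
      refine Literature.Analysis.Complex.differentiableOn_integral_of_dominated
        (fun t ht => (aestronglyMeasurable_weight hρ.1 (hσm t ht.1)).smul (hmeas (move U₀ p t))) ?_ ?_
      · filter_upwards [hσd, hHd] with z hz hHz
        exact ((hz.cexp.const_mul (ρ₀ z : ℂ)).mono inter_subset_left).smul (hHz.mono inter_subset_right)
      · intro t₀ ht₀
        obtain ⟨R', hR', hRΩ⟩ := Metric.isOpen_iff.mp (hΩ.inter (isOpen_tube _)) t₀ ht₀
        refine ⟨R', hR', hRΩ, fun z => ‖ρ₀ z‖ * Real.exp s * A, (hρ.norm.mul_const _).mul_const _, ?_⟩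
        filter_upwards [hσb, hHb] with z hz hHz t ht
        rw [norm_smul, Real.norm_eq_abs]
        exact mul_le_mul (norm_weight_le (hz t (hRΩ ht).1)) (hHz t (hRΩ ht).2) (norm_nonneg _) (by positivity)
    exact (((hG.mono inter_subset_left).inv fun t ht => hne t ht.1).smul hH).congr fun t ht => hEq t ht.1
  · intro t ht
    beta_reduce
    rw [hEq t ht.1]
    exact norm_ratio_le hρ hρ0 hP (hσm t ht.1) (hσb' t ht.1) hs (hHb' t ht.2) hA

variable {ref : V → V} {base : V → ℝ} {𝒜 𝒬 : V → V → ℂ}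

/-- **ONE DRESSED STEP OF A CARRIED TERM, FED BY THE DRESSED EXPONENT DATA** (§3 + §6): action-exponent data about `ref`
(oscillation `s`), a perturbation slice for `𝒬` (oscillation `s₁`), `s + s₁ ≤ 1`, and a carried term as in `birthSlice_wOp_shift`
give the transformed term a birth slice of radius `ϱ` and size `e^{3(s+s₁)}·A` on the fine window. [folklore] -/
theorem birthSlice_wOp_shift_dressed [CompleteSpace F] {μ : Measure V} {z₀ : V} {𝒦 𝒦big : Set V} {w ϱ s s₁ r A : ℝ}
    {G : V → F} (hmove : ∀ (U z : V) (d : Dir) (t : ℂ), move (U + z) d t = move U d t + z)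
    (hB : RealBaseAt ref base 𝒜 μ 𝒦) (hE : ExponentSliceAt ref 𝒜 μ move N 𝒦 w ϱ s) (hP : PertSlice 𝒬 μ move N 𝒦 w ϱ s₁)
    (hs : s + s₁ ≤ 1) (hsl : BirthSlice G move N 𝒦big w r A) (hnest : ∀ᵐ z ∂μ, ∀ U₀ ∈ 𝒦, U₀ + z ∈ 𝒦big)
    (hmeas : ∀ U, AEStronglyMeasurable (fun z => G (U + z)) μ) (hϱr : ϱ < r) (hA : 0 ≤ A) :
    BirthSlice (fun U => wOp (expWeight base (𝒜 + 𝒬)) μ z₀ U (fun z => G (U + z))) move N 𝒦 w ϱ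
      (Real.exp (3 * (s + s₁)) * A) :=
  birthSlice_wOp_shift hmove (weightSliceProj_of_dressed hB hE hP) hs hsl hnest hmeas hϱr hA

end Carried

/-! ## §7 Consistency: at `𝒬 = 0` the dressed capstone IS the v1.2.1 capstone [folklore] -/

section Consistency

variable {B : Booking} {T : Trajectory B}
variable {R : Type*} [NormedRing R] [NormedAlgebra ℂ R] [MeasurableSpace R] {d : ℕ}
  {F : Type*} [NormedAddCommGroup F] [NormedSpace ℂ F] [CompleteSpace F]

/-- CONSISTENCY — the statement of `T4TrajectoryDensity.transportsFromVar_of_exponentSlicesAt_lattice` (v1.2.1) VERBATIM, derived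
from part 1's dressed capstone with the zero perturbation (`pertSlice_const 0`, size `0`): the (w2)-split generalises the seam and
loses nothing.  Kept as an `example` (its TYPE is, by design, the landed v1.2.1 theorem's — cite THAT theorem by name downstream;
this re-derivation is a consistency certificate, not a second copy). [folklore] -/
example {Gate : ℕ → Prop} {Fn : B.Birth → ℕ → ℕ → Fld d R → F}
    {rel : B.Birth → ℕ → ℕ → Fld d R → Fld d R → Prop} {𝒦 : B.Birth → ℕ → ℕ → Set (Fld d R)}
    {ref : ℕ → Fld d R → Fld d R} {base : ℕ → Fld d R → ℝ} {𝒜 : ℕ → Fld d R → Fld d R → ℂ}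
    {μ : ℕ → Measure (Fld d R)} {z₀ : ℕ → Fld d R} {D : ℕ → Set (Fld d R)}
    {defect : B.Birth → ℕ → ℕ → ℝ} {cδ ψ w r : ℝ} {s α θ : ℕ → ℝ} {ϱ : B.Birth → ℕ → ℕ → ℝ}
    (hα : ∀ i, 0 ≤ α i) (hr : 0 < r) (hw : 0 < w)
    (hsl : ∀ (b : B.Birth) (k' : ℕ), B.birthScale b ≤ k' → k' ≤ B.K → RanBelow Gate k' →
      BirthSlice (Fn b k' k') latMove latN (𝒦 b k' k') w r (T.gen b k'))
    (hFn : ∀ (b : B.Birth) (k' k : ℕ), B.birthScale b ≤ k' → k' ≤ k → k + 1 ≤ B.K → RanBelow Gate (k + 1) →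
      ∀ U, Fn b k' (k + 1) U = wOp (expWeight (base k) (𝒜 k)) (μ k) (z₀ k) U (fun z => Fn b k' k (U + z)))
    (h𝒢 : ∀ (b : B.Birth) (k' k : ℕ), B.birthScale b ≤ k' → k' ≤ k → k + 1 ≤ B.K → RanBelow Gate (k + 1) →
      ∀ U, (fun z => Fn b k' k (U + z)) ∈ BddClass F (μ k))
    (hD : ∀ k, (D k).Nonempty) (hϱ : ∀ b k' k, 0 < ϱ b k' k)
    (hB : ∀ (b : B.Birth) (k' k : ℕ), B.birthScale b ≤ k' → k' ≤ k → k + 1 ≤ B.K → RanBelow Gate (k + 1) →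
      RealBaseAt (ref k) (base k) (𝒜 k) (μ k) (𝒦 b k' (k + 1)))
    (hE : ∀ (b : B.Birth) (k' k : ℕ), B.birthScale b ≤ k' → k' ≤ k → k + 1 ≤ B.K → RanBelow Gate (k + 1) →
      ExponentSliceAt (ref k) (𝒜 k) (μ k) latMove latN (𝒦 b k' (k + 1)) w (ϱ b k' k) (s k))
    (hs : ∀ k, s k ≤ 1) (hDμ : ∀ k, ∀ᵐ z ∂μ k, z ∈ D k)
    (hN1 : ∀ (b : B.Birth) (k' k : ℕ), B.birthScale b ≤ k' → k' ≤ k → k + 1 ≤ B.K →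
      ∀ z ∈ D k, ∀ U ∈ 𝒦 b k' (k + 1), U + z ∈ 𝒦 b k' k)
    (hN2 : ∀ (b : B.Birth) (k' k : ℕ), B.birthScale b ≤ k' → k' ≤ k → k + 1 ≤ B.K →
      ∀ U₀ ∈ 𝒦 b k' (k + 1), ∀ p : NDir d R, latN p ≤ w → ∀ z' ∈ D k, latMove U₀ p 1 + z' ∈ 𝒦 b k' k)
    (hdiam : ∀ k, ∀ z ∈ D k, ∀ z' ∈ D k, ∀ x ν, ‖z x ν - z' x ν‖ ≤ θ k)
    (hθ : ∀ k, 0 < θ k ∧ θ k ≤ w)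
    (hdom : ∀ (b : B.Birth) (k' k : ℕ), B.birthScale b ≤ k' → k' ≤ k → k + 1 ≤ B.K →
      Real.exp (3 * s k) * (1 + 4 * θ k / ϱ b k' k) ≤ α k)
    (hinv : ∀ b k' k, GaugeInvariant (rel b k' k) (Fn b k' k))
    (hdefw : ∀ b k' k, defect b k' k ≤ w)
    (hrate : ∀ (b : B.Birth) (k' k : ℕ), B.birthScale b ≤ k' → k' ≤ k → k ≤ B.K →
      defect b k' k ≤ cδ * ψ ^ (k - k'))
    (hlin : ∀ (b : B.Birth) (k' k : ℕ), B.birthScale b ≤ k' → k' ≤ k → k ≤ B.K → RanBelow Gate k → ∀ ε > 0,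
      ∃ U₀ ∈ 𝒦 b k' k, ∃ U₁ : Fld d R, RelGauge (rel b k' k) latMove latN U₀ U₁ (defect b k' k) ∧
        T.lin b k' k ≤ ‖Fn b k' k U₁ - Fn b k' k U₀‖ + ε) :
    T.TransportsFromVar (4 * cδ / r) (fun i => ψ * α i) Gate := by
  have e : ∀ k, (𝒜 k + fun (_ : Fld d R) (_ : Fld d R) => (0 : ℂ)) = 𝒜 k := fun k => by
    funext U z
    simp
  refine transportsFromVar_of_dressedExponent_lattice (𝒬 := fun _ _ _ => (0 : ℂ)) (s₁ := fun _ => 0) hα hr hw hsl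
    (fun b k' k h₁ h₂ h₃ h₄ U => by rw [e]; exact hFn b k' k h₁ h₂ h₃ h₄ U) h𝒢 hD hϱ hB hE
    (fun b k' k _ _ _ _ => pertSlice_const 0) (fun k => by simpa using hs k) hDμ hN1 hN2 hdiam hθ
    (fun b k' k h₁ h₂ h₃ => by simpa using hdom b k' k h₁ h₂ h₃) hinv hdefw hrate hlin

end Consistency

/-! ## §8 The scalar size bookkeeping along the trajectory: μ-uniformity ⟺ summable oscillation budgets (typed) [folklore] -/

section Budget

/-- **SIZES ALONG THE TRAJECTORY.**  A carried term's size obeying the one-step law of §6, `A_{k+1} ≤ e^{3 s_k}·A_k` (`s_k` = the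
full oscillation budget of step `k`), satisfies `A_k ≤ A_0·e^{3 Σ_{i<k} s_i}`. [folklore] -/
theorem size_le_of_rec {A s : ℕ → ℝ} (hrec : ∀ k, A (k + 1) ≤ Real.exp (3 * s k) * A k) :
    ∀ k, A k ≤ A 0 * Real.exp (3 * ∑ i ∈ Finset.range k, s i) := by
  intro k
  induction k with
  | zero => simp
  | succ k ih =>
    calc A (k + 1) ≤ Real.exp (3 * s k) * A k := hrec k
      _ ≤ Real.exp (3 * s k) * (A 0 * Real.exp (3 * ∑ i ∈ Finset.range k, s i)) :=
          mul_le_mul_of_nonneg_left ih (Real.exp_pos _).le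
      _ = A 0 * Real.exp (3 * ∑ i ∈ Finset.range (k + 1), s i) := by
          rw [Finset.sum_range_succ, mul_add, Real.exp_add]; ring

/-- **K-UNIFORM SIZES UNDER SUMMABLE OSCILLATION BUDGETS** — the typed input OBS-SUM: if `Σ_{i<k} s_i ≤ S` for all `k` with `S`
independent of the number of met steps, then `A_k ≤ A_0·e^{3S}` for ALL `k`.  (With `s_k = s⁰_k + s₁_k` this is the μ-UNIFORM size
bound of the observable-attached terms; `S` K-free is exactly what print does not supply for the observable part.) [folklore] -/
theorem size_uniform_of_summable {A s : ℕ → ℝ} {S : ℝ} (hA : ∀ k, 0 ≤ A k)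
    (hrec : ∀ k, A (k + 1) ≤ Real.exp (3 * s k) * A k) (hS : ∀ k, ∑ i ∈ Finset.range k, s i ≤ S) :
    ∀ k, A k ≤ A 0 * Real.exp (3 * S) := fun k =>
  (size_le_of_rec hrec k).trans
    (mul_le_mul_of_nonneg_left (Real.exp_le_exp.mpr (by linarith [hS k])) (hA 0))

/-- **NO OSCILLATION DECAY ⇒ GEOMETRIC GROWTH.**  If the observable-attached oscillation at step `k` is fed back in its SUP form
`s₁_k = m·A_k` (§5 about the constant `0`; `m ≥ 0` ∝ the source strength) and the step law holds from BELOW,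
`e^{3(s⁰_k + m·A_k)}·A_k ≤ A_{k+1}` (`s⁰ ≥ 0`, `A_0 ≥ 0` — no contraction anywhere), then `A_k ≥ A_0·(1 + 3mA_0)^k`. [folklore] -/
theorem size_lb_noContraction {A s₀ : ℕ → ℝ} {m : ℝ} (hA0 : 0 ≤ A 0) (hm : 0 ≤ m) (hs : ∀ k, 0 ≤ s₀ k)
    (hrec : ∀ k, Real.exp (3 * (s₀ k + m * A k)) * A k ≤ A (k + 1)) :
    ∀ k, A 0 * (1 + 3 * (m * A 0)) ^ k ≤ A k := by
  have hmono : ∀ k, A 0 ≤ A k ∧ 0 ≤ A k := by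
    intro k
    induction k with
    | zero => exact ⟨le_rfl, hA0⟩
    | succ k ih =>
      have hx : 0 ≤ 3 * (s₀ k + m * A k) := by nlinarith [hs k, hm, ih.2]
      have h1 : A k ≤ A (k + 1) :=
        calc A k = 1 * A k := (one_mul _).symm
          _ ≤ Real.exp (3 * (s₀ k + m * A k)) * A k :=
              mul_le_mul_of_nonneg_right (by linarith [Real.add_one_le_exp (3 * (s₀ k + m * A k))]) ih.2
          _ ≤ A (k + 1) := hrec k
      exact ⟨ih.1.trans h1, ih.2.trans h1⟩
  intro k
  induction k with
  | zero => simp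
  | succ k ih =>
    have hAk := hmono k
    have hexp : 1 + 3 * (m * A k) ≤ Real.exp (3 * (s₀ k + m * A k)) := by
      linarith [Real.add_one_le_exp (3 * (s₀ k + m * A k)), hs k]
    have hmA : m * A 0 ≤ m * A k := mul_le_mul_of_nonneg_left hAk.1 hm
    have hq : 0 ≤ 1 + 3 * (m * A 0) := by nlinarith [hm, hA0]
    calc A 0 * (1 + 3 * (m * A 0)) ^ (k + 1) = (A 0 * (1 + 3 * (m * A 0)) ^ k) * (1 + 3 * (m * A 0)) := by ring
      _ ≤ A k * (1 + 3 * (m * A k)) := mul_le_mul ih (by linarith) hq hAk.2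
      _ ≤ A k * Real.exp (3 * (s₀ k + m * A k)) := mul_le_mul_of_nonneg_left hexp hAk.2
      _ = Real.exp (3 * (s₀ k + m * A k)) * A k := mul_comm _ _
      _ ≤ A (k + 1) := hrec k

/-- **THE SOURCE STRENGTH SHRINKS WITH `K` WITHOUT AN OSCILLATION-DECAY INPUT.**  Under `size_lb_noContraction`'s law, the per-step
oscillation budget at the last met step, `m·A_K ≤ 1/2` (so that `s⁰_K + s₁_K ≤ 1` is available with `s⁰_K ≤ 1/2`), forces
`m·A_0·(1 + 3mA_0)^K ≤ 1/2`: for fixed `A_0 > 0` the admissible `m` (∝ `|μ|`) tends to `0` as `K → ∞`.  This is the typed content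
of "μ-uniformity needs more than (1.75)": the missing input is a K-uniform bound on the SUMMED OSCILLATIONS of the
observable-attached exponent (OBS-SUM, `size_uniform_of_summable`), NOT PRINTED. [folklore] -/
theorem source_bound_noContraction {A s₀ : ℕ → ℝ} {m : ℝ} {K : ℕ} (hA0 : 0 ≤ A 0) (hm : 0 ≤ m) (hs : ∀ k, 0 ≤ s₀ k)
    (hrec : ∀ k, Real.exp (3 * (s₀ k + m * A k)) * A k ≤ A (k + 1)) (hbud : m * A K ≤ 1 / 2) :
    m * A 0 * (1 + 3 * (m * A 0)) ^ K ≤ 1 / 2 :=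
  calc m * A 0 * (1 + 3 * (m * A 0)) ^ K = m * (A 0 * (1 + 3 * (m * A 0)) ^ K) := by ring
    _ ≤ m * A K := mul_le_mul_of_nonneg_left (size_lb_noContraction hA0 hm hs hrec K) hm
    _ ≤ 1 / 2 := hbud

/-- DECIDED SANITY of the shrinking: already at `K = 25` met steps, `m·A_0 = 1/10` violates the last-step budget
(`(1/10)·(13/10)^25 > 1/2`), while at `K = 1` it does not. [folklore] -/
example : ¬ ((1 / 10 : ℝ) * (1 + 3 * (1 / 10)) ^ 25 ≤ 1 / 2) ∧ ((1 / 10 : ℝ) * (1 + 3 * (1 / 10)) ^ 1 ≤ 1 / 2) := by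
  constructor <;> norm_num

end Budget

end

end Summit.QuantumFields.BalabanUV.T4Continuum.T4TrajectoryDensityDressed
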